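import Summits.NavierStokesRegularity.NavierStokesRegularity.Theses.HardyPointSink
import Literature.Analysis.FluidPDE.KatoFarFieldBound
import Literature.Analysis.FluidPDE.LerayFarFieldRegularity
import Literature.Analysis.FluidPDE.RusinSverakLerayExistenceHolds
import Literature.Analysis.FluidPDE.LocalEnergyExtensionHolds
import Literature.Analysis.FluidPDE.LocalLerayWeakStrongUniquenessHolds
import Literature.Analysis.FluidPDE.JiaSverak2013Lemma8Holds
import Literature.Analysis.FluidPDE.LocalLerayLimitIdentification
import Literature.Analysis.FluidPDE.RusinSverakWeakLimitBlowupFourLeaves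
import Literature.Analysis.FluidPDE.SuitableWeakInBallTools
import Literature.Analysis.FluidPDE.LocalTypeIMorreyProofs
import Literature.Analysis.FluidPDE.LocalTypeIScaling
import Literature.Analysis.FluidPDE.NSLerayHopfSereginEnergyProofs
import Literature.Analysis.FluidPDE.KatoMaximalTimeSingular

/-!
# Route HardyPointSink — `HardyTypeIExtraction` (item stmt-NavierStokesRegularity-7982)

Summit-side proof file for the support item `HardyTypeIExtraction` of route
`route-NavierStokesRegularity-HardyPointSink`: a Clay datum `u₀` without global Kato solution
at viscosity `ν`, all of whose Kato solutions obey the local Hardy bound of `HardyEnergyBound`,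
yields a Hardy-bounded local Type-I singular point in the sense of Albritton–Barker 2019
(`IsLocalTypeISingularPoint`).

## Proof (bookkeeping over engines proved in the tree)

Everything is done at unit viscosity. Put `w₀ = ν⁻¹ u₀` (`w₀ ∈ L³`, weakly divergence free,
no global Kato solution at viscosity `1` by `hasGlobalKatoSolution_smul_iff`). Let
`T₁ = katoMaximalTime 1 w₀ ∈ (0, ∞)` (`kato_local_holds`, `kato_unique_holds`), `v` the maximal
Kato solution on `[0, T₁)` (`exists_isKatoSolutionOn_katoMaximalTime`) and `(T₁, x₀)` its
singular point (`lemarieRieusset_singular_point_of_blowup_holds`, Lemarié-Rieusset 2016,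
Thm. 15.1 (C)). The field `ν v(ν ·)` is a Kato solution at viscosity `ν` from `u₀`
(`IsKatoSolutionOn.timeRescale`), so the hypothesis gives the Hardy bound
`∫_{B(x₀,r₀)} |v(s)|²/|x - x'| ≤ K/ν²` for `x' ∈ B(x₀, r₀)` and `T₁ - ν r₀² < s < T₁`.

The witness is the Leray solution `(w, π)` of `w₀` (`leray_solution_exists_of_memLp_three_holds`),
which agrees with `v` a.e. on `(0, T₁) × ℝ³` (`leray_solution_ae_eq_kato_holds`). Being a
suitable weak solution on the whole open slab `(0, ∞) × ℝ³`, it lies in Albritton–Barker's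
class (Def. 2.1) on every parabolic ball `Q((T₁, x₀), R)` with `R² < T₁`
(`IsSuitableWeakSolutionOn.isSuitableWeakSolutionInBall`); the Hardy bound dominates the scaled
energy `A` of every parabolic sub-ball (`|x - x'| < r` on `B(x', r)`), so after zooming to the
unit ball (`IsSuitableWeakSolutionInBall.zoom`, `cknAEss_nsZoom`) Albritton–Barker's Lemma 2.6
(`albrittonBarker2019_lemma_2_6_holds`, case `A`; Seregin 2006, Lemma 2.1 (c)) gives
`𝐈(Q(0, 1/2)) < ∞`, i.e. `𝐈(Q((T₁, x₀), R/2)) < ∞` (`typeIBound_nsZoom`). The singularity of `v`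
transfers to `w` along the a.e. equality (`eLpNorm_parabolicCylinder_eq_top_of_ae_eq`), and so
does the Hardy bound, for a.e. time (Fubini).

## References

* D. Albritton, T. Barker, J. Math. Fluid Mech. 21 (2019) = arXiv:1811.00502, Def. 2.1,
  Lemma 2.6.
* G. Seregin, arXiv:math/0607537 = J. Math. Sci. 143 (2007), Lemma 2.1 (c).
* P. G. Lemarié-Rieusset, *The Navier–Stokes Problem in the 21st Century*, CRC 2016,
  Thm. 15.1.
* W. Rusin, V. Šverák, J. Funct. Anal. 260 (2011) = arXiv:0911.0500, §4 (Leray solutions,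
  Thm. 4.1).
-/

noncomputable section

open Literature.Analysis.FluidPDE MeasureTheory Set Function Filter Topology Metric
open scoped ENNReal NNReal InnerProductSpace RealInnerProductSpace

namespace Summit.NavierStokesRegularity.NavierStokesRegularity.Theorems

/-! ### Two elementary tools -/

/-- **The Hardy energy dominates the scaled energy `A`.** If, for a.e. `t` in a time window
`(a, T)` and every centre `x' ∈ B(x₀, ρ)`, `∫_{B(x₀,ρ)} |u(t,x)|² / |x - x'| dx ≤ K`, then every
parabolic ball `Q(z', r)` with times in `(a, T)` and ball in `B(x₀, ρ)` has
`A(Q(z', r)) = esssup_t r⁻¹ ∫_{B(x',r)} |u|² ≤ K` (on `B(x', r)` one has `r⁻¹ ≤ |x - x'|⁻¹`).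
[folklore] -/
theorem hardyPointSink_cknAEss_le_of_hardy
    {u : ℝ → EuclideanSpace ℝ (Fin 3) → EuclideanSpace ℝ (Fin 3)} {x₀ : EuclideanSpace ℝ (Fin 3)}
    {a T ρ : ℝ} {K : ℝ≥0∞}
    (hH : ∀ᵐ t ∂(volume.restrict (Ioo a T)), ∀ x' ∈ ball x₀ ρ,
      ∫⁻ x in ball x₀ ρ, ‖u t x‖ₑ ^ 2 / ‖x - x'‖ₑ ≤ K)
    {r : ℝ} (hr : 0 < r) {z' : ℝ × EuclideanSpace ℝ (Fin 3)}
    (hI : Ioo (z'.1 - r ^ 2) z'.1 ⊆ Ioo a T)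
    (hB : ball z'.2 r ⊆ ball x₀ ρ) : cknAEss r z' u ≤ K := by
  unfold cknAEss
  refine essSup_le_of_ae_le K ?_
  filter_upwards [ae_restrict_of_ae_restrict_of_subset hI hH] with t ht
  have hx' : z'.2 ∈ ball x₀ ρ := hB (mem_ball_self hr)
  have hr0 : (ENNReal.ofReal r)⁻¹ ≠ ⊤ := ENNReal.inv_ne_top.2 (ENNReal.ofReal_pos.2 hr).ne'
  calc (ENNReal.ofReal r)⁻¹ * ∫⁻ x in ball z'.2 r, ‖u t x‖ₑ ^ 2
      = ∫⁻ x in ball z'.2 r, (ENNReal.ofReal r)⁻¹ * ‖u t x‖ₑ ^ 2 :=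
        (lintegral_const_mul' _ _ hr0).symm
    _ ≤ ∫⁻ x in ball z'.2 r, ‖u t x‖ₑ ^ 2 / ‖x - z'.2‖ₑ := by
        refine lintegral_mono_ae ?_
        filter_upwards [ae_restrict_mem measurableSet_ball] with x hx
        have hlt : edist x z'.2 < ENNReal.ofReal r := by
          rw [edist_dist]
          exact (ENNReal.ofReal_lt_ofReal_iff hr).2 (mem_ball.1 hx)
        rw [mul_comm, div_eq_mul_inv, ← edist_eq_enorm_sub]
        exact mul_le_mul_right (ENNReal.inv_le_inv' hlt.le) _
    _ ≤ ∫⁻ x in ball x₀ ρ, ‖u t x‖ₑ ^ 2 / ‖x - z'.2‖ₑ := lintegral_mono_set hB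
    _ ≤ K := ht z'.2 hx'

/-- **The local Hardy energy under the viscosity normalisation** `u(t, x) = ν ũ(ν t, x)`
(`timeRescale ν ν`): `∫_S |ũ(s)|²/|x - x'| = ν⁻² ∫_S |u(s/ν)|²/|x - x'|`. [folklore] -/
theorem hardyPointSink_lintegral_hardy_timeRescale {ν : ℝ} (hν : 0 < ν)
    (v : ℝ → EuclideanSpace ℝ (Fin 3) → EuclideanSpace ℝ (Fin 3)) (s : ℝ)
    (x' : EuclideanSpace ℝ (Fin 3)) (S : Set (EuclideanSpace ℝ (Fin 3))) :
    ∫⁻ x in S, ‖v s x‖ₑ ^ 2 / ‖x - x'‖ₑ =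
      ENNReal.ofReal (ν⁻¹ ^ 2) * ∫⁻ x in S, ‖timeRescale ν ν v (s / ν) x‖ₑ ^ 2 / ‖x - x'‖ₑ := by
  have hts : ν * (s / ν) = s := by field_simp
  have hpt : ∀ x, v s x = ν⁻¹ • timeRescale ν ν v (s / ν) x := fun x => by
    rw [timeRescale_apply, hts, inv_smul_smul₀ hν.ne']
  calc ∫⁻ x in S, ‖v s x‖ₑ ^ 2 / ‖x - x'‖ₑ
      = ∫⁻ x in S, ENNReal.ofReal (ν⁻¹ ^ 2) *
          (‖timeRescale ν ν v (s / ν) x‖ₑ ^ 2 / ‖x - x'‖ₑ) := by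
        refine lintegral_congr fun x => ?_
        rw [hpt x, enorm_smul, mul_pow, Real.enorm_eq_ofReal (inv_nonneg.2 hν.le),
          ENNReal.ofReal_pow (inv_nonneg.2 hν.le), mul_div_assoc]
    _ = _ := lintegral_const_mul' _ _ ENNReal.ofReal_ne_top

/-! ### The item -/

/-- **`HardyTypeIExtraction`** (item stmt-NavierStokesRegularity-7982 of route HardyPointSink):
a Clay datum `u₀` without global Kato solution at viscosity `ν > 0`, all of whose Kato
solutions satisfy the local Hardy bound of `HardyEnergyBound`, yields a Hardy-bounded local
Type-I singular point: `∃ r₀ z u p`, `IsLocalTypeISingularPoint r₀ z u p` and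
`∫_{B(z.2,r₀)} |u(t,x)|²/|x - x'| ≤ K` for all `x' ∈ B(z.2, r₀)` and a.e. `t ∈ (z.1 - r₀², z.1)`.
The witness is the Leray solution at unit viscosity of the normalised datum `ν⁻¹ u₀`, on a
small parabolic ball at the singular point `(T_max, x₀)` of the maximal Kato solution; see the
module docstring for the chain of tree results (Lemarié-Rieusset 2016 Thm. 15.1 (C),
Rusin–Šverák 2011 Thm. 4.1, Albritton–Barker 2019 Lemma 2.6 / Seregin 2006 Lemma 2.1 (c)). -/
theorem hardyTypeIExtraction_proof :
    Summit.NavierStokesRegularity.NavierStokesRegularity.Theses.HardyPointSink.HardyTypeIExtraction :=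
  by
  intro ν hν u₀ hsm hdiv hdec hng hH
  classical
  /- ### the datum: `L³`, weakly divergence free; its normalisation `w₀ = ν⁻¹ u₀` -/
  have hHk : ∀ n : ℕ, ∫⁻ x, ‖iteratedFDeriv ℝ n u₀ x‖ₑ ^ 2 < ⊤ :=
    hdec.lintegral_enorm_iteratedFDeriv_sq_lt_top
  have hmeas0 : AEStronglyMeasurable u₀ volume := hsm.continuous.aestronglyMeasurable
  have hL2 : ∫⁻ x, ‖u₀ x‖ₑ ^ 2 < ⊤ := by
    refine lt_of_le_of_lt (le_of_eq (lintegral_congr fun x => ?_)) (hHk 0)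
    rw [← ofReal_norm, ← ofReal_norm, norm_iteratedFDeriv_zero]
  have hu2 : MemLp u₀ 2 volume := ⟨hmeas0, eLpNorm_two_lt_top_of_lintegral_enorm_sq_lt_top hL2⟩
  obtain ⟨C₀, hC₀⟩ := hdec 0 0
  have hbd0 : ∀ x, ‖u₀ x‖ ≤ C₀ := fun x => by
    have h := hC₀ x
    rwa [pow_zero, one_mul, norm_iteratedFDeriv_zero] at h
  have hu3 : MemLp u₀ 3 volume := by
    refine ⟨hmeas0, ?_⟩
    have h3 : eLpNorm u₀ 3 volume ^ 3 ≤ eLpNorm u₀ ⊤ volume * eLpNorm u₀ 2 volume ^ 2 :=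
      eLpNorm_three_pow_le hmeas0
    have htop : eLpNorm u₀ ⊤ volume ≤ ENNReal.ofReal C₀ := eLpNorm_top_le_of_bound hbd0
    have hfin : eLpNorm u₀ ⊤ volume * eLpNorm u₀ 2 volume ^ 2 < ⊤ :=
      ENNReal.mul_lt_top (htop.trans_lt ENNReal.ofReal_lt_top)
        (ENNReal.pow_lt_top hu2.eLpNorm_lt_top)
    by_contra hnot
    rw [not_lt, top_le_iff] at hnot
    rw [hnot, ENNReal.top_pow (by norm_num)] at h3
    exact absurd (h3.trans_lt hfin) (lt_irrefl _)
  have hdiv' : VectorCalculus.IsDivFree u₀ := fun x => hdiv x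
  have hwdiv : IsWeaklyDivFree u₀ :=
    VectorCalculus.IsDivFree.isWeaklyDivFree_holds hdiv' (hsm.of_le (mod_cast le_top))
  set w₀ : EuclideanSpace ℝ (Fin 3) → EuclideanSpace ℝ (Fin 3) := ν⁻¹ • u₀ with hw₀_def
  have hw3 : MemLp w₀ 3 volume := hu3.const_smul ν⁻¹
  have hwdiv₀ : IsWeaklyDivFree w₀ := hwdiv.const_smul ν⁻¹
  have hng1 : ¬ HasGlobalKatoSolution 1 w₀ := by
    intro h
    have e := hasGlobalKatoSolution_smul_iff (inv_pos.2 hν) (ν := ν) (u₀ := u₀)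
    rw [inv_mul_cancel₀ hν.ne'] at e
    exact hng (e.1 h)
  /- ### the Kato maximal time at unit viscosity and the singular point -/
  have hTm0 : 0 < katoMaximalTime 1 w₀ :=
    katoMaximalTime_pos kato_local_holds one_pos hw3 hwdiv₀
  have htop : katoMaximalTime 1 w₀ ≠ ⊤ := fun h =>
    hng1 (hasGlobalKatoSolution_of_katoMaximalTime_eq_top kato_unique_holds one_pos h)
  have htop' : katoMaximalTime 1 w₀ < ⊤ := lt_top_iff_ne_top.2 htop
  obtain ⟨v, hv⟩ :=
    exists_isKatoSolutionOn_katoMaximalTime kato_unique_holds one_pos hTm0 htop'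
  set T₁ : ℝ := (katoMaximalTime 1 w₀).toReal with hT₁_def
  have hT₁ : 0 < T₁ := ENNReal.toReal_pos hTm0.ne' htop
  have hofReal : ENNReal.ofReal T₁ = katoMaximalTime 1 w₀ := ENNReal.ofReal_toReal htop
  have hmax : ∀ T'' : ℝ, T₁ < T'' → ∀ v' : ℝ → EuclideanSpace ℝ (Fin 3) → EuclideanSpace ℝ (Fin 3),
      ¬ IsKatoSolutionOn T'' 1 w₀ v' :=
    fun T'' hT'' v' => not_isKatoSolutionOn_of_katoMaximalTime_lt (by
      rw [← hofReal]
      exact (ENNReal.ofReal_lt_ofReal_iff (hT₁.trans hT'')).2 hT'')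
  obtain ⟨x₀, hx₀⟩ :=
    lemarieRieusset_singular_point_of_blowup_holds one_pos hT₁ hw3 hwdiv₀ hv hmax
  have hallv : ∀ r : ℝ, 0 < r →
      eLpNorm (uncurry v) ⊤ (volume.restrict (parabolicCylinder r ((T₁ : ℝ), x₀))) = ⊤ :=
    fun r hr => eLpNorm_top_parabolicCylinder_eq_top_of_small hT₁ hx₀ hr
  /- ### the Hardy bound for `v`, from the hypothesis applied to `ν v(ν ·)` -/
  have hu' : IsKatoSolutionOn (T₁ / ν) ν u₀ (timeRescale ν ν v) := by
    have h := hv.timeRescale hν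
    rwa [mul_one, hw₀_def, smul_inv_smul₀ hν.ne'] at h
  obtain ⟨r₀, hr₀, K, hK⟩ := hH (T₁ / ν) (timeRescale ν ν v) (div_pos hT₁ hν) hu' x₀
  set K₁ : ℝ≥0 := Real.toNNReal (ν⁻¹ ^ 2) * K with hK₁_def
  have hK₁ : (K₁ : ℝ≥0∞) = ENNReal.ofReal (ν⁻¹ ^ 2) * K := by
    rw [hK₁_def, ENNReal.coe_mul]
    rfl
  have hKv : ∀ s ∈ Ico 0 T₁, T₁ - ν * r₀ ^ 2 < s → ∀ x' ∈ ball x₀ r₀,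
      ∫⁻ x in ball x₀ r₀, ‖v s x‖ₑ ^ 2 / ‖x - x'‖ₑ ≤ K₁ := by
    intro s hs hlt x' hx'
    rw [hardyPointSink_lintegral_hardy_timeRescale hν v s x' (ball x₀ r₀), hK₁]
    refine mul_le_mul_right (hK x' hx' (s / ν) ⟨div_nonneg hs.1 hν.le, ?_⟩ ?_) _
    · exact div_lt_div_of_pos_right hs.2 hν
    · have e : T₁ / ν - r₀ ^ 2 = (T₁ - ν * r₀ ^ 2) / ν := by field_simp
      rw [e]
      exact div_lt_div_of_pos_right hlt hν
  /- ### the Leray solution of `w₀`: the witness -/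
  obtain ⟨w, π, hw⟩ := leray_solution_exists_of_memLp_three_holds w₀ hw3 hwdiv₀
  -- Rusin–Šverák Thm. 4.1 (**W**, `leray_solution_ae_eq_kato`) from its four discharged leaves
  have hW : leray_solution_ae_eq_kato :=
    (leray_theory_inputs_of_four_leaves
      localEnergySolution_extension_of_memE2_holds local_leray_weak_strong_uniqueness_holds
      jia_sverak_2013_lemma_8_holds localLeray_limit_isLocalLeraySolution_holds).2.1
  have hae : uncurry w =ᵐ[volume.restrict (Ioo 0 T₁ ×ˢ (univ : Set (EuclideanSpace ℝ (Fin 3))))]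
      uncurry v :=
    hW w₀ hw3 hwdiv₀ w π hw T₁ v hv
  -- slice-wise form of the a.e. equality
  have hslice : ∀ᵐ t ∂(volume.restrict (Ioo 0 T₁)), w t =ᵐ[volume] v t := by
    have hprod : ((volume : Measure (ℝ × EuclideanSpace ℝ (Fin 3))).restrict (Ioo 0 T₁ ×ˢ univ)) =
        ((volume : Measure ℝ).restrict (Ioo 0 T₁)).prod
          (volume : Measure (EuclideanSpace ℝ (Fin 3))) := by
      rw [Measure.volume_eq_prod,
        ← Measure.restrict_univ (μ := (volume : Measure (EuclideanSpace ℝ (Fin 3)))),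
        Measure.prod_restrict, Measure.restrict_univ]
    rw [hprod] at hae
    filter_upwards [Measure.ae_ae_of_ae_prod hae] with t ht
    filter_upwards [ht] with x hx
    exact hx
  -- the Hardy bound for `w`, a.e. in time
  have hHw : ∀ᵐ t ∂(volume.restrict (Ioo 0 T₁)), T₁ - ν * r₀ ^ 2 < t → ∀ x' ∈ ball x₀ r₀,
      ∫⁻ x in ball x₀ r₀, ‖w t x‖ₑ ^ 2 / ‖x - x'‖ₑ ≤ K₁ := by
    filter_upwards [hslice, ae_restrict_mem measurableSet_Ioo] with t ht htI hlt x' hx'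
    have e : ∫⁻ x in ball x₀ r₀, ‖w t x‖ₑ ^ 2 / ‖x - x'‖ₑ =
        ∫⁻ x in ball x₀ r₀, ‖v t x‖ₑ ^ 2 / ‖x - x'‖ₑ :=
      lintegral_congr_ae (ae_restrict_of_ae (ht.mono fun x hx => by simp only [hx]))
    rw [e]
    exact hKv t ⟨htI.1.le, htI.2⟩ hlt x' hx'
  -- the singular point transfers to `w`
  have hallw : ∀ r : ℝ, 0 < r →
      eLpNorm (uncurry w) ⊤ (volume.restrict (parabolicCylinder r ((T₁ : ℝ), x₀))) = ⊤ :=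
    fun r hr => eLpNorm_parabolicCylinder_eq_top_of_ae_eq hT₁ hae x₀ hallv hr
  /- ### the parabolic ball `Q((T₁, x₀), R)` -/
  set R : ℝ := min r₀ (min (Real.sqrt ν * r₀) (Real.sqrt (T₁ / 2))) with hR_def
  have hR : 0 < R := lt_min hr₀ (lt_min (mul_pos (Real.sqrt_pos.2 hν) hr₀)
    (Real.sqrt_pos.2 (half_pos hT₁)))
  have hRr₀ : R ≤ r₀ := min_le_left _ _
  have hRν : R ^ 2 ≤ ν * r₀ ^ 2 := by
    calc R ^ 2 ≤ (Real.sqrt ν * r₀) ^ 2 :=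
          pow_le_pow_left₀ hR.le ((min_le_right _ _).trans (min_le_left _ _)) 2
      _ = ν * r₀ ^ 2 := by rw [mul_pow, Real.sq_sqrt hν.le]
  have hRT : R ^ 2 ≤ T₁ / 2 := by
    calc R ^ 2 ≤ Real.sqrt (T₁ / 2) ^ 2 :=
          pow_le_pow_left₀ hR.le ((min_le_right _ _).trans (min_le_right _ _)) 2
      _ = T₁ / 2 := Real.sq_sqrt (half_pos hT₁).le
  set z : ℝ × EuclideanSpace ℝ (Fin 3) := ((T₁ : ℝ), x₀) with hz_def
  -- closed parabolic boxes at `z` of radius `ρ ≤ R` lie in the open slab `(0, ∞) × ℝ³`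
  have hbox : ∀ {ρ : ℝ}, ρ ^ 2 ≤ R ^ 2 →
      Icc (z.1 - ρ ^ 2) z.1 ×ˢ closedBall z.2 ρ ⊆
        ((slab (EuclideanSpace ℝ (Fin 3)) (Ioi 0) isOpen_Ioi :
          TopologicalSpace.Opens (ℝ × EuclideanSpace ℝ (Fin 3))) :
            Set (ℝ × EuclideanSpace ℝ (Fin 3))) := by
    intro ρ hρ p hp
    rw [coe_slab]
    refine ⟨?_, mem_univ _⟩
    have h1 : z.1 - ρ ^ 2 ≤ p.1 := hp.1.1
    show 0 < p.1
    have hz1 : z.1 = T₁ := rfl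
    rw [hz1] at h1
    linarith
  have hInBall : IsSuitableWeakSolutionInBall R z w π :=
    hw.suitable.isSuitableWeakSolutionInBall (hbox le_rfl)
  -- the Hardy bound on the time window of `Q(z, R)`, and the bound on `A` of its sub-balls
  have hHwR : ∀ᵐ t ∂(volume.restrict (Ioo (z.1 - R ^ 2) z.1)), ∀ x' ∈ ball x₀ r₀,
      ∫⁻ x in ball x₀ r₀, ‖w t x‖ₑ ^ 2 / ‖x - x'‖ₑ ≤ K₁ := by
    have hsubI : Ioo (z.1 - R ^ 2) z.1 ⊆ Ioo 0 T₁ :=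
      Ioo_subset_Ioo (by show 0 ≤ T₁ - R ^ 2; linarith) le_rfl
    filter_upwards [ae_restrict_of_ae_restrict_of_subset hsubI hHw,
      ae_restrict_mem measurableSet_Ioo] with t ht htI
    exact ht (by have h1 : T₁ - R ^ 2 < t := htI.1; linarith)
  have hAw : ∀ {r : ℝ}, 0 < r → ∀ {z' : ℝ × EuclideanSpace ℝ (Fin 3)},
      parabolicCylinder r z' ⊆ parabolicCylinder R z → cknAEss r z' w ≤ K₁ := by
    intro r hr z' hsub
    obtain ⟨hI, hB, -⟩ := parabolicCylinder_subset_data hr hsub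
    exact hardyPointSink_cknAEss_le_of_hardy hHwR hr hI (hB.trans (ball_subset_ball hRr₀))
  /- ### zoom to the unit ball and Albritton–Barker's Lemma 2.6 (case `A`) -/
  obtain ⟨G, hG, -⟩ := hInBall.2.2.1
  set V : ℝ → EuclideanSpace ℝ (Fin 3) → EuclideanSpace ℝ (Fin 3) :=
    R • stPull (R ^ 2) R z.1 z.2 w with hV_def
  set P : ℝ → EuclideanSpace ℝ (Fin 3) → ℝ := R ^ 2 • stPull (R ^ 2) R z.1 z.2 π with hP_def
  have hV : IsSuitableWeakSolutionInBall 1 (0 : ℝ × EuclideanSpace ℝ (Fin 3)) V P :=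
    hInBall.zoom hR
  have hGV : HasWeakSpatialGradientOn
      (parabolicCylinderOpens 1 (0 : ℝ × EuclideanSpace ℝ (Fin 3))) V
      ((R * R) • stPull (R ^ 2) R z.1 z.2 G) := by
    rw [← zoom_stPreimage_parabolicCylinderOpens hR z]
    exact hG.stRescale R (pow_pos hR 2) hR z.1 z.2
  have eG : (R * R) • stPull (R ^ 2) R z.1 z.2 G = R ^ 2 • stPull (R ^ 2) R z.1 z.2 G := by
    rw [sq]
  rw [eG] at hGV
  have hsurj : Function.Surjective (stAffine (R ^ 2) R z.1 z.2) :=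
    (stAffineHomeomorph (pow_ne_zero 2 hR.ne') hR.ne' z.1 z.2).surjective
  have hAV : (⨆ (r : ℝ) (_ : 0 < r) (z' : ℝ × EuclideanSpace ℝ (Fin 3))
      (_ : parabolicCylinder r z' ⊆ parabolicCylinder 1 (0 : ℝ × EuclideanSpace ℝ (Fin 3))),
        cknAEss r z' V) < ⊤ := by
    refine lt_of_le_of_lt ?_ (ENNReal.coe_lt_top (r := K₁))
    refine iSup_le fun r => iSup_le fun hr => iSup_le fun z' => iSup_le fun hz' => ?_
    rw [hV_def, cknAEss_nsZoom hR hr]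
    refine hAw (mul_pos hR hr) fun y hy => ?_
    obtain ⟨y', rfl⟩ := hsurj y
    have hy' : y' ∈ parabolicCylinder r z' := by
      rw [← LocalTypeIScaling.stAffine_preimage_parabolicCylinder hR z.1 z.2 r z']
      exact hy
    have hy1 : y' ∈ parabolicCylinder 1 (0 : ℝ × EuclideanSpace ℝ (Fin 3)) := hz' hy'
    rw [← zoom_preimage_parabolicCylinder_self hR z] at hy1
    exact hy1
  have h26 := albrittonBarker2019_lemma_2_6_holds 0 V P hV _ hGV (Or.inl hAV) (1 / 2)
    (by norm_num) (by norm_num)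
  have hI : typeIBound (parabolicCylinder (R / 2) z) w π G < ⊤ := by
    rw [← typeIBound_nsZoom hR z.1 z.2 (parabolicCylinder (R / 2) z) w π G,
      zoom_preimage_parabolicCylinder_half hR z]
    exact h26
  /- ### conclusion -/
  have hR2 : 0 < R / 2 := half_pos hR
  have hR2sq : (R / 2) ^ 2 ≤ R ^ 2 := pow_le_pow_left₀ hR2.le (half_le_self hR.le) 2
  refine ⟨R / 2, z, w, π, ⟨hR2, hw.suitable.isSuitableWeakSolutionInBall (hbox hR2sq), hallw,
    G, hG.mono ?_, hI⟩, K₁, ?_⟩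
  · intro p hp
    exact parabolicCylinder_mono hR2.le (half_le_self hR.le) z hp
  · intro x' hx'
    have hx'r₀ : x' ∈ ball x₀ r₀ := ball_subset_ball ((half_le_self hR.le).trans hRr₀) hx'
    have hsubI : Ioo (z.1 - (R / 2) ^ 2) z.1 ⊆ Ioo 0 T₁ :=
      Ioo_subset_Ioo (by show 0 ≤ T₁ - (R / 2) ^ 2; linarith) le_rfl
    filter_upwards [ae_restrict_of_ae_restrict_of_subset hsubI hHw,
      ae_restrict_mem measurableSet_Ioo] with t ht htI
    have h1 : T₁ - (R / 2) ^ 2 < t := htI.1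
    have hlt : T₁ - ν * r₀ ^ 2 < t := by linarith
    exact (lintegral_mono_set (ball_subset_ball ((half_le_self hR.le).trans hRr₀))).trans
      (ht hlt x' hx'r₀)

end Summit.NavierStokesRegularity.NavierStokesRegularity.Theorems

end
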